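import Summits.HubbardSuperconductivity.HubbardSuperconductivity.Theorems.AposterioriCapRgSeededBrokenRegimeBoseFermiPinnedPolchinskiSeedFlow

/-!
# The SCALE FLOW (Salmhofer's RG differential equation) of the countertermed effective action of the Hubbard torus
# (crux `SeededBrokenRegimeBoseFermiPinned` = stmt-HubbardSuperconductivity-14047, route AposterioriCapRg)

Support file (`--supports stmt-HubbardSuperconductivity-14047`).  The scale `Λ` enters `hubbardCovAboveCT L M β μ h K Λ`
only through Salmhofer's SMOOTH cutoff `χ₂((ω² + e_K²)/Λ²)` (`salmhoferCutoff`, `ContDiff`), so the covariance above scale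
is entrywise differentiable in `Λ ≠ 0` and the landed Polchinski equation `hasDerivAt_apply_effAction` gives THE RG
DIFFERENTIAL EQUATION of the tree's Wilsonian effective action `Λ ↦ 𝒢^K_Λ = hubbardEffectiveActionCT L M β U μ h K Λ` in
the infrared scale, with its quadratic term (Salmhofer 1999, Prop. 4.3, (4.89)–(4.91)), weakly (through every linear
functional), at every finite `L ≥ 1`, `M`, `β`, `U`, `μ`, seed `h`, frame `K`, scale `Λ ≠ 0` with `Z^K_Λ ≠ 0`:

* `hasDerivAt_hubbardCutoffWeightCT_scale`, `hasDerivAt_hubbardCovAboveCT_scale` — entrywise differentiability in `Λ`.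
* **`scaleFlow_hubbardEffectiveActionCT`** — `∂_Λ 𝒢 = Δ_{∂_ΛC} 𝒢 - ½ Σ_{X,Y} ∂_ΛC(X,Y) ∂_X𝒢 ∂_Y𝒢 + (∂_ΛZ/Z) · 1`.

This is the equation every RG line of the route (symmetric regime [2] and seeded broken regime [3]) integrates; stated
here for the record in the tree's own objects. Sources: `Salmhofer1999` Prop. 4.3; folklore bookkeeping otherwise.
-/

set_option linter.dupNamespace false -- `Summit.<S>.<S>` doubles the summit name (tree convention)

namespace Summit.HubbardSuperconductivity.HubbardSuperconductivity.Theorems.AposterioriCapRgSeededBrokenRegimeBoseFermiPinned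

open Literature.MathematicalPhysics.QuantumLattice Literature.Probability.LatticeModels GrassmannAlgebra

/-- **The CT cutoff weight is differentiable in the scale** `Λ ≠ 0` (smooth cutoff composed with `Λ ↦ c/Λ²`). [folklore] -/
theorem hasDerivAt_hubbardCutoffWeightCT_scale :
    ∀ (L M : ℕ) (β μ : ℝ) (K : TrigPolyC4v) (Λ : ℝ) (k : FreqMomentum L M), Λ ≠ 0 →
      HasDerivAt (fun Λ' : ℝ => hubbardCutoffWeightCT L M β μ K Λ' k)
        (deriv (fun Λ' : ℝ => hubbardCutoffWeightCT L M β μ K Λ' k) Λ) Λ := by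
  intro L M β μ K Λ k hΛ
  refine DifferentiableAt.hasDerivAt ?_
  unfold hubbardCutoffWeightCT
  refine ((contDiff_salmhoferCutoff (n := 1)).differentiable (by simp)).differentiableAt.comp Λ ?_
  exact (differentiableAt_const _).div (differentiableAt_pow 2) (pow_ne_zero 2 hΛ)

/-- **The CT covariance above scale is entrywise differentiable in the scale** `Λ ≠ 0`. [folklore] -/
theorem hasDerivAt_hubbardCovAboveCT_scale :
    ∀ (L M : ℕ) (β μ h : ℝ) (K : TrigPolyC4v) (Λ : ℝ) (X Y : HubbardFieldIdx L M), Λ ≠ 0 →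
      HasDerivAt (fun Λ' : ℝ => hubbardCovAboveCT L M β μ h K Λ' X Y)
        (deriv (fun Λ' : ℝ => hubbardCovAboveCT L M β μ h K Λ' X Y) Λ) Λ := by
  intro L M β μ h K Λ X Y hΛ
  refine DifferentiableAt.hasDerivAt ?_
  have hw : DifferentiableAt ℝ (fun Λ' : ℝ => (((hubbardCutoffWeightCT L M β μ K Λ' (momentumOf L M X) +
      hubbardCutoffWeightCT L M β μ K Λ' (momentumOf L M Y)) / 2 : ℝ) : ℂ)) Λ := by
    have hr : DifferentiableAt ℝ (fun Λ' : ℝ => (hubbardCutoffWeightCT L M β μ K Λ' (momentumOf L M X) +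
        hubbardCutoffWeightCT L M β μ K Λ' (momentumOf L M Y)) / 2) Λ :=
      ((hasDerivAt_hubbardCutoffWeightCT_scale L M β μ K Λ _ hΛ).differentiableAt.add
        (hasDerivAt_hubbardCutoffWeightCT_scale L M β μ K Λ _ hΛ).differentiableAt).div_const 2
    exact (hr.hasDerivAt.ofReal_comp).differentiableAt
  simpa only [hubbardCovAboveCT, Matrix.of_apply] using hw.mul_const (hubbardCovarianceCT L M β μ h K X Y)

/-- **THE SCALE FLOW (RG differential equation) of the countertermed effective action of the Hubbard torus**
(Salmhofer 1999, Prop. 4.3, (4.89)–(4.91), normalised convention): for `Λ ≠ 0` and `Z^K_Λ ≠ 0`, weakly through every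
linear functional, `∂_Λ 𝒢^K_Λ = Δ_{∂_ΛC} 𝒢 - ½ Σ_{X,Y} ∂_ΛC(X,Y) ∂_X𝒢 ∂_Y𝒢 + (∂_ΛZ/Z) · 1`, with `∂_ΛC` the entrywise
`Λ`-derivative of `hubbardCovAboveCT L M β μ h K Λ` and `∂_ΛZ = constPart (Δ_{∂_ΛC} (μ_{C_Λ} ⋆ e^{-(V + 𝒩_K)}))`.
[cite: Salmhofer1999, Prop. 4.3 (4.89)] -/
theorem scaleFlow_hubbardEffectiveActionCT :
    ∀ (L M : ℕ) [NeZero L] (β U μ h : ℝ) (K : TrigPolyC4v) (Λ : ℝ), Λ ≠ 0 →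
      hubbardEffPartitionFnCT L M β U μ h K Λ ≠ 0 → ∀ φ : HubbardGrassmann L M →ₗ[ℂ] ℂ,
        HasDerivAt (fun Λ' : ℝ => φ (hubbardEffectiveActionCT L M β U μ h K Λ'))
          (φ (grassmannLaplacian ℂ (Matrix.of fun X Y : HubbardFieldIdx L M => deriv (fun Λ' : ℝ => hubbardCovAboveCT L M β μ h K Λ' X Y) Λ)
                (hubbardEffectiveActionCT L M β U μ h K Λ) -
              (1 / 2 : ℂ) • ∑ X, ∑ Y, deriv (fun Λ' : ℝ => hubbardCovAboveCT L M β μ h K Λ' X Y) Λ •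
                (grassmannDeriv ℂ X (hubbardEffectiveActionCT L M β U μ h K Λ) *
                  grassmannDeriv ℂ Y (hubbardEffectiveActionCT L M β U μ h K Λ)) +
              (constPart ℂ (grassmannLaplacian ℂ
                  (Matrix.of fun X Y : HubbardFieldIdx L M => deriv (fun Λ' : ℝ => hubbardCovAboveCT L M β μ h K Λ' X Y) Λ)
                  (effBoltzmann ℂ (hubbardCovAboveCT L M β μ h K Λ) (hubbardInteractionCT L M β U K))) /
                hubbardEffPartitionFnCT L M β U μ h K Λ) • 1)) Λ := by
  intro L M _ β U μ h K Λ hΛ hZ φ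
  have hC : ∀ X Y : HubbardFieldIdx L M, HasDerivAt (fun Λ' : ℝ => hubbardCovAboveCT L M β μ h K Λ' X Y)
      ((Matrix.of fun X Y : HubbardFieldIdx L M => deriv (fun Λ' : ℝ => hubbardCovAboveCT L M β μ h K Λ' X Y) Λ) X Y) Λ :=
    fun X Y => hasDerivAt_hubbardCovAboveCT_scale L M β μ h K Λ X Y hΛ
  exact hasDerivAt_apply_effAction (fun Λ' : ℝ => hubbardCovAboveCT L M β μ h K Λ') _ Λ hC
    (hubbardInteractionCT_mem_evenOdd_zero L M β U K) hZ φ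

end Summit.HubbardSuperconductivity.HubbardSuperconductivity.Theorems.AposterioriCapRgSeededBrokenRegimeBoseFermiPinned
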